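import Summits.AtomisticToContinuum.HydrodynamicLimit.Theorems.RelayRaceLocalityLightConeInLawSVCLine
import Mathlib.Analysis.SpecificLimits.Normed

/-!
# Exponential families of weights on `ℕ` with almost-constant insertion ratios: moments and variance

Helper file (`--supports stmt-AtomisticToContinuum-12500`) of the line `susceptibility-variance-continuity`
of the crux `LightConeInLaw`, for the stub `stub_countLCLT`. Pure discrete analysis, no hard spheres.

A probability weight `p` on `ℕ` is a **count family with activity `ν` and insertion probabilities `g`**
if `(n+1) p(n+1) = ν g(n) p(n)` with `0 ≤ g ≤ 1` (for the Poissonised canonical ensemble of a hard-core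
gas, `g(n) = Z_{n+1}/Z_n` is the mean free-volume fraction seen by an `(n+1)`-st particle). Then
(`tsum_mul_nat_eq`, `tsum_mul_nat_mul_pred_eq`) `E n = ν E g`, `E n(n-1) = ν² E g(n)g(n+1)`, so that
`Var n = ν² (E g(n)g(n+1) - (E g)²) + ν E g` (`var_eq`); the weights are dominated by a Poisson law
(`le_pow_div_factorial`), have geometric tails beyond `2ν` (`tail_le`), and `E n ≤ ν` (`mean_le`).
If moreover `g ≥ 1 - λ ≥ 1/2` on `[0, G]` and `g` is `D`-Lipschitz there, with `ν D ≤ 1/8`, `G ≥ 4ν + 3`,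
`ν ≥ 32`, then the count variance is two-sided linear: `ν/4 ≤ Var n ≤ 2ν` (`countFamily_variance`):
`E g(n)g(n+1) = E g² + O(D)`, and `Var g ≤ D² E (n - n₀)²` by the Lipschitz bound.
-/

namespace Summit.AtomisticToContinuum.HydrodynamicLimit.Theorems.LightConeInLawSVC.CountLCLT

open scoped BigOperators
open Finset

noncomputable section

variable {p g : ℕ → ℝ} {ν : ℝ}

/-! ### Domination by a Poisson law and summability -/

/-- One step of the family: `p(n+1) ≤ ν p(n)/(n+1)`. [folklore] -/
theorem succ_le (hp : ∀ n, 0 ≤ p n) (hrat : ∀ n, p (n + 1) * ((n : ℝ) + 1) = ν * g n * p n)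
    (hg1 : ∀ n, g n ≤ 1) (hν : 0 < ν) (n : ℕ) : p (n + 1) ≤ ν * p n / ((n : ℝ) + 1) := by
  have hn : (0 : ℝ) < (n : ℝ) + 1 := by positivity
  rw [le_div_iff₀ hn, hrat n]
  calc ν * g n * p n ≤ ν * 1 * p n :=
        mul_le_mul_of_nonneg_right (mul_le_mul_of_nonneg_left (hg1 n) hν.le) (hp n)
    _ = ν * p n := by ring

/-- **Poisson domination**: `p(n) ≤ p(0) νⁿ/n!`. [folklore] -/
theorem le_pow_div_factorial (hp : ∀ n, 0 ≤ p n)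
    (hrat : ∀ n, p (n + 1) * ((n : ℝ) + 1) = ν * g n * p n) (hg1 : ∀ n, g n ≤ 1) (hν : 0 < ν)
    (n : ℕ) : p n ≤ p 0 * ν ^ n / (n.factorial : ℝ) := by
  induction n with
  | zero => simp
  | succ n ih =>
      have h := succ_le hp hrat hg1 hν n
      have hn : (0 : ℝ) < (n : ℝ) + 1 := by positivity
      calc p (n + 1) ≤ ν * p n / ((n : ℝ) + 1) := h
        _ ≤ ν * (p 0 * ν ^ n / (n.factorial : ℝ)) / ((n : ℝ) + 1) := by gcongr
        _ = p 0 * ν ^ (n + 1) / ((n + 1).factorial : ℝ) := by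
            rw [Nat.factorial_succ, Nat.cast_mul, pow_succ]; push_cast; field_simp

/-- **Summability of quadratically bounded moments**: `Σ p(n) φ(n)` converges absolutely whenever
`|φ(n)| ≤ C (n+1)²` (domination by `p(0) C (4ν)ⁿ/n!`). [folklore] -/
theorem summable_mul_of_le (hp : ∀ n, 0 ≤ p n)
    (hrat : ∀ n, p (n + 1) * ((n : ℝ) + 1) = ν * g n * p n) (hg1 : ∀ n, g n ≤ 1) (hν : 0 < ν)
    {φ : ℕ → ℝ} {C : ℝ} (hφ : ∀ n, |φ n| ≤ C * ((n : ℝ) + 1) ^ 2) :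
    Summable fun n => p n * φ n := by
  have hC : 0 ≤ C := by
    have h := hφ 0
    simp only [Nat.cast_zero, zero_add, one_pow, mul_one] at h
    exact (abs_nonneg _).trans h
  refine Summable.of_norm_bounded ((Real.summable_pow_div_factorial (4 * ν)).mul_left (p 0 * C)) fun n => ?_
  rw [Real.norm_eq_abs, abs_mul, abs_of_nonneg (hp n)]
  have h2 : ((n : ℝ) + 1) ^ 2 ≤ 4 ^ n := by
    have h1 : (n : ℝ) + 1 ≤ 2 ^ n := by exact_mod_cast Nat.lt_two_pow_self
    calc ((n : ℝ) + 1) ^ 2 ≤ (2 ^ n) ^ 2 := pow_le_pow_left₀ (by positivity) h1 2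
      _ = 4 ^ n := by rw [← pow_mul, mul_comm, pow_mul]; norm_num
  have hp0 := hp 0
  calc p n * |φ n| ≤ (p 0 * ν ^ n / (n.factorial : ℝ)) * (C * ((n : ℝ) + 1) ^ 2) :=
        mul_le_mul (le_pow_div_factorial hp hrat hg1 hν n) (hφ n) (abs_nonneg _) (by positivity)
    _ ≤ (p 0 * ν ^ n / (n.factorial : ℝ)) * (C * 4 ^ n) := by gcongr
    _ = p 0 * C * ((4 * ν) ^ n / (n.factorial : ℝ)) := by rw [mul_pow]; ring

/-- Summability of the first moment. [folklore] -/
theorem summable_mul_nat (hp : ∀ n, 0 ≤ p n)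
    (hrat : ∀ n, p (n + 1) * ((n : ℝ) + 1) = ν * g n * p n) (hg1 : ∀ n, g n ≤ 1) (hν : 0 < ν) :
    Summable fun n => p n * (n : ℝ) :=
  summable_mul_of_le hp hrat hg1 hν (C := 1) fun n => by
    have hn0 : (0 : ℝ) ≤ n := Nat.cast_nonneg n
    rw [Nat.abs_cast]; nlinarith

/-- Summability of the second moment. [folklore] -/
theorem summable_mul_sq (hp : ∀ n, 0 ≤ p n)
    (hrat : ∀ n, p (n + 1) * ((n : ℝ) + 1) = ν * g n * p n) (hg1 : ∀ n, g n ≤ 1) (hν : 0 < ν) :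
    Summable fun n => p n * (n : ℝ) ^ 2 :=
  summable_mul_of_le hp hrat hg1 hν (C := 1) fun n => by
    have hn0 : (0 : ℝ) ≤ n := Nat.cast_nonneg n
    rw [abs_of_nonneg (by positivity)]; nlinarith

/-- Summability of the second factorial moment. [folklore] -/
theorem summable_mul_nat_mul_pred (hp : ∀ n, 0 ≤ p n)
    (hrat : ∀ n, p (n + 1) * ((n : ℝ) + 1) = ν * g n * p n) (hg1 : ∀ n, g n ≤ 1) (hν : 0 < ν) :
    Summable fun n => p n * ((n : ℝ) * ((n : ℝ) - 1)) :=
  summable_mul_of_le hp hrat hg1 hν (C := 1) fun n => by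
    have hn0 : (0 : ℝ) ≤ n := Nat.cast_nonneg n
    rw [abs_mul, Nat.abs_cast]
    have : |(n : ℝ) - 1| ≤ (n : ℝ) + 1 := by
      rw [abs_le]; constructor <;> linarith
    nlinarith [abs_nonneg ((n : ℝ) - 1)]

/-- Summability against a bounded decoration `|h| ≤ B`. [folklore] -/
theorem summable_mul_of_abs_le (hp : ∀ n, 0 ≤ p n)
    (hrat : ∀ n, p (n + 1) * ((n : ℝ) + 1) = ν * g n * p n) (hg1 : ∀ n, g n ≤ 1) (hν : 0 < ν)
    {h : ℕ → ℝ} {B : ℝ} (hB : ∀ n, |h n| ≤ B) : Summable fun n => p n * h n :=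
  summable_mul_of_le hp hrat hg1 hν (C := B) fun n => by
    have hn0 : (0 : ℝ) ≤ n := Nat.cast_nonneg n
    have hB0 : 0 ≤ B := (abs_nonneg _).trans (hB 0)
    calc |h n| ≤ B := hB n
      _ = B * 1 := (mul_one B).symm
      _ ≤ B * ((n : ℝ) + 1) ^ 2 := by gcongr; nlinarith

/-! ### Moment identities -/

/-- **First moment**: `Σ p(n) n = ν Σ p(n) g(n)`. [folklore] -/
theorem tsum_mul_nat_eq (hp : ∀ n, 0 ≤ p n)
    (hrat : ∀ n, p (n + 1) * ((n : ℝ) + 1) = ν * g n * p n) (hg1 : ∀ n, g n ≤ 1) (hν : 0 < ν) :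
    ∑' n, p n * (n : ℝ) = ν * ∑' n, p n * g n := by
  have hs := summable_mul_nat hp hrat hg1 hν
  rw [hs.tsum_eq_zero_add, Nat.cast_zero, mul_zero, zero_add, ← tsum_mul_left]
  refine tsum_congr fun n => ?_
  push_cast
  rw [hrat n]; ring

/-- **Second factorial moment**: `Σ p(n) n(n-1) = ν² Σ p(n) g(n) g(n+1)`. [folklore] -/
theorem tsum_mul_nat_mul_pred_eq (hp : ∀ n, 0 ≤ p n)
    (hrat : ∀ n, p (n + 1) * ((n : ℝ) + 1) = ν * g n * p n) (hg1 : ∀ n, g n ≤ 1) (hν : 0 < ν) :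
    ∑' n, p n * ((n : ℝ) * ((n : ℝ) - 1)) = ν ^ 2 * ∑' n, p n * (g n * g (n + 1)) := by
  have hs := summable_mul_nat_mul_pred hp hrat hg1 hν
  have hs1 : Summable fun n => p (n + 1) * (((n + 1 : ℕ) : ℝ) * (((n + 1 : ℕ) : ℝ) - 1)) :=
    (summable_nat_add_iff 1).mpr hs
  rw [hs.tsum_eq_zero_add, hs1.tsum_eq_zero_add, ← tsum_mul_left]
  simp only [Nat.cast_zero, zero_mul, mul_zero, zero_add, Nat.cast_one, sub_self]
  refine tsum_congr fun n => ?_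
  have h1 := hrat (n + 1)
  have h0 := hrat n
  push_cast at h1 ⊢
  have e1 : p (n + 1 + 1) * (((n : ℝ) + 1 + 1) * ((n : ℝ) + 1 + 1 - 1)) =
      (p (n + 1 + 1) * ((n : ℝ) + 1 + 1)) * ((n : ℝ) + 1) := by ring
  rw [e1, h1]
  have e2 : ν * g (n + 1) * p (n + 1) * ((n : ℝ) + 1) = ν * g (n + 1) * (p (n + 1) * ((n : ℝ) + 1)) := by
    ring
  rw [e2, h0]; ring

/-- **The mean is at most the activity**: `Σ p(n) n ≤ ν`. [folklore] -/
theorem mean_le (hp : ∀ n, 0 ≤ p n) (hsum : HasSum p 1)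
    (hrat : ∀ n, p (n + 1) * ((n : ℝ) + 1) = ν * g n * p n) (hg0 : ∀ n, 0 ≤ g n)
    (hg1 : ∀ n, g n ≤ 1) (hν : 0 < ν) : ∑' n, p n * (n : ℝ) ≤ ν := by
  rw [tsum_mul_nat_eq hp hrat hg1 hν]
  have hsg : Summable fun n => p n * g n :=
    summable_mul_of_abs_le hp hrat hg1 hν (B := 1) fun n => by rw [abs_of_nonneg (hg0 n)]; exact hg1 n
  have h1 : ∑' n, p n * g n ≤ ∑' n, p n := by
    refine hsg.tsum_le_tsum (fun n => ?_) hsum.summable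
    calc p n * g n ≤ p n * 1 := mul_le_mul_of_nonneg_left (hg1 n) (hp n)
      _ = p n := mul_one _
  rw [hsum.tsum_eq] at h1
  calc ν * ∑' n, p n * g n ≤ ν * 1 := mul_le_mul_of_nonneg_left h1 hν.le
    _ = ν := mul_one ν

/-- **The variance formula**: with `M = Σ p(n) n`,
`Σ p(n) n² - M² = ν² (Σ p g(n)g(n+1) - (Σ p g)²) + ν Σ p g`. [folklore] -/
theorem var_eq (hp : ∀ n, 0 ≤ p n)
    (hrat : ∀ n, p (n + 1) * ((n : ℝ) + 1) = ν * g n * p n) (hg1 : ∀ n, g n ≤ 1) (hν : 0 < ν) :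
    ∑' n, p n * (n : ℝ) ^ 2 - (∑' n, p n * (n : ℝ)) ^ 2 =
      ν ^ 2 * (∑' n, p n * (g n * g (n + 1)) - (∑' n, p n * g n) ^ 2) + ν * ∑' n, p n * g n := by
  have h2 : ∑' n, p n * (n : ℝ) ^ 2 = ∑' n, p n * ((n : ℝ) * ((n : ℝ) - 1)) + ∑' n, p n * (n : ℝ) := by
    rw [← (summable_mul_nat_mul_pred hp hrat hg1 hν).tsum_add (summable_mul_nat hp hrat hg1 hν)]
    exact tsum_congr fun n => by ring
  rw [h2, tsum_mul_nat_mul_pred_eq hp hrat hg1 hν, tsum_mul_nat_eq hp hrat hg1 hν]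
  ring

/-! ### Tails -/

/-- Each weight is at most one. [folklore] -/
theorem le_one (hp : ∀ n, 0 ≤ p n) (hsum : HasSum p 1) (n : ℕ) : p n ≤ 1 := by
  calc p n ≤ ∑' k, p k := hsum.summable.le_tsum n fun j _ => hp j
    _ = 1 := hsum.tsum_eq

/-- **Geometric decay beyond `2ν`**: `p(n₂ + k) ≤ p(n₂) 2^{-k}` once `2ν ≤ n₂`. [folklore] -/
theorem add_le_mul_half_pow (hp : ∀ n, 0 ≤ p n)
    (hrat : ∀ n, p (n + 1) * ((n : ℝ) + 1) = ν * g n * p n) (hg1 : ∀ n, g n ≤ 1) (hν : 0 < ν)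
    {n₂ : ℕ} (hn₂ : 2 * ν ≤ n₂) (k : ℕ) : p (n₂ + k) ≤ p n₂ * (1 / 2) ^ k := by
  induction k with
  | zero => simp
  | succ k ih =>
      have h := succ_le hp hrat hg1 hν (n₂ + k)
      have hpos : (0 : ℝ) < ((n₂ + k : ℕ) : ℝ) + 1 := by positivity
      have hk0 : (0 : ℝ) ≤ k := Nat.cast_nonneg k
      have hνle : ν / (((n₂ + k : ℕ) : ℝ) + 1) ≤ 1 / 2 := by
        rw [div_le_div_iff₀ hpos (by norm_num)]
        push_cast
        nlinarith
      rw [← add_assoc]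
      calc p (n₂ + k + 1) ≤ ν * p (n₂ + k) / (((n₂ + k : ℕ) : ℝ) + 1) := h
        _ = ν / (((n₂ + k : ℕ) : ℝ) + 1) * p (n₂ + k) := by ring
        _ ≤ (1 / 2) * (p n₂ * (1 / 2) ^ k) := mul_le_mul hνle ih (hp _) (by norm_num)
        _ = p n₂ * (1 / 2) ^ (k + 1) := by ring

/-- **Tail bound**: `Σ_k p(k + n₂ + j) ≤ 2 · 2^{-j}` once `2ν ≤ n₂`. [folklore] -/
theorem tail_le (hp : ∀ n, 0 ≤ p n) (hsum : HasSum p 1)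
    (hrat : ∀ n, p (n + 1) * ((n : ℝ) + 1) = ν * g n * p n) (hg1 : ∀ n, g n ≤ 1) (hν : 0 < ν)
    {n₂ : ℕ} (hn₂ : 2 * ν ≤ n₂) (j : ℕ) : ∑' k, p (k + (n₂ + j)) ≤ 2 * (1 / 2) ^ j := by
  have hgeo : HasSum (fun k : ℕ => (1 / 2 : ℝ) ^ j * (1 / 2) ^ k) ((1 / 2) ^ j * 2) :=
    hasSum_geometric_two.mul_left ((1 / 2 : ℝ) ^ j)
  have hle : ∀ k, p (k + (n₂ + j)) ≤ (1 / 2 : ℝ) ^ j * (1 / 2) ^ k := by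
    intro k
    have h := add_le_mul_half_pow hp hrat hg1 hν hn₂ (j + k)
    rw [show k + (n₂ + j) = n₂ + (j + k) by ring]
    calc p (n₂ + (j + k)) ≤ p n₂ * (1 / 2) ^ (j + k) := h
      _ ≤ 1 * (1 / 2) ^ (j + k) := mul_le_mul_of_nonneg_right (le_one hp hsum n₂) (by positivity)
      _ = (1 / 2) ^ j * (1 / 2) ^ k := by rw [one_mul, pow_add]
  have hs : Summable fun k => p (k + (n₂ + j)) := (summable_nat_add_iff (n₂ + j)).mpr hsum.summable
  calc ∑' k, p (k + (n₂ + j)) ≤ ∑' k, (1 / 2 : ℝ) ^ j * (1 / 2) ^ k := hs.tsum_le_tsum hle hgeo.summable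
    _ = (1 / 2) ^ j * 2 := hgeo.tsum_eq
    _ = 2 * (1 / 2) ^ j := mul_comm _ _

/-- **The tail beyond `G ≥ 4ν + 3` is `≤ 2/ν²`** (for `ν ≥ 1`). [folklore] -/
theorem tail_le_of_ge (hp : ∀ n, 0 ≤ p n) (hsum : HasSum p 1)
    (hrat : ∀ n, p (n + 1) * ((n : ℝ) + 1) = ν * g n * p n) (hg1 : ∀ n, g n ≤ 1)
    (hν1 : 1 ≤ ν) {G : ℕ} (hG : 4 * ν + 3 ≤ G) : ∑' k, p (k + G) ≤ 2 / ν ^ 2 := by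
  have hν : 0 < ν := one_pos.trans_le hν1
  set n₂ : ℕ := ⌈2 * ν⌉₊ with hn₂def
  set k₀ : ℕ := ⌈ν⌉₊ with hk₀def
  have hn₂ : 2 * ν ≤ n₂ := Nat.le_ceil _
  have hn₂' : (n₂ : ℝ) < 2 * ν + 1 := Nat.ceil_lt_add_one (by positivity)
  have hk₀ : ν ≤ k₀ := Nat.le_ceil _
  have hk₀' : (k₀ : ℝ) < ν + 1 := Nat.ceil_lt_add_one (by positivity)
  have hGn : n₂ + 2 * k₀ ≤ G := by
    have h : ((n₂ + 2 * k₀ : ℕ) : ℝ) ≤ G := by push_cast; linarith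
    exact_mod_cast h
  obtain ⟨j, hj⟩ : ∃ j, G = n₂ + j := ⟨G - n₂, by omega⟩
  have hj2 : 2 * k₀ ≤ j := by omega
  rw [hj]
  refine (tail_le hp hsum hrat hg1 hν hn₂ j).trans ?_
  have h2k : ν ≤ (2 : ℝ) ^ k₀ := by
    have h : (k₀ : ℝ) < 2 ^ k₀ := by exact_mod_cast Nat.lt_two_pow_self
    linarith
  have hν2 : 0 < ν ^ 2 := by positivity
  calc 2 * (1 / 2 : ℝ) ^ j ≤ 2 * (1 / 2) ^ (2 * k₀) :=
        mul_le_mul_of_nonneg_left (pow_le_pow_of_le_one (by norm_num) (by norm_num) hj2) (by norm_num)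
    _ = 2 / (2 ^ k₀) ^ 2 := by rw [← pow_mul, mul_comm k₀ 2, one_div_pow]; ring
    _ ≤ 2 / ν ^ 2 := by gcongr

/-- Splitting the mass at `G`: `Σ_{n<G} p(n) + Σ_k p(k + G) = 1`. [folklore] -/
theorem sum_add_tail (hsum : HasSum p 1) (G : ℕ) : ∑ n ∈ range G, p n + ∑' k, p (k + G) = 1 := by
  rw [hsum.summable.sum_add_tsum_nat_add G, hsum.tsum_eq]

/-! ### A priori bounds on the mean -/

/-- **Lower bounds on the mean**: `ν (1-λ) Σ_{n ≤ G} p(n) ≤ M` if `g ≥ 1 - λ` on `[0, G]`, and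
`(G+1) Σ_k p(k + G + 1) ≤ M`. [folklore] -/
theorem mean_ge (hp : ∀ n, 0 ≤ p n) (hsum : HasSum p 1)
    (hrat : ∀ n, p (n + 1) * ((n : ℝ) + 1) = ν * g n * p n) (hg0 : ∀ n, 0 ≤ g n)
    (hg1 : ∀ n, g n ≤ 1) (hν : 0 < ν) {G : ℕ} {lam : ℝ} (hgl : ∀ n, n ≤ G → 1 - lam ≤ g n) :
    ν * (1 - lam) * ∑ n ∈ range (G + 1), p n ≤ ∑' n, p n * (n : ℝ) ∧
      ((G : ℝ) + 1) * ∑' k, p (k + (G + 1)) ≤ ∑' n, p n * (n : ℝ) := by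
  have hs := summable_mul_nat hp hrat hg1 hν
  have hsg : Summable fun n => p n * g n :=
    summable_mul_of_abs_le hp hrat hg1 hν (B := 1) fun n => by rw [abs_of_nonneg (hg0 n)]; exact hg1 n
  constructor
  · rw [tsum_mul_nat_eq hp hrat hg1 hν, mul_assoc]
    refine mul_le_mul_of_nonneg_left ?_ hν.le
    rw [mul_sum]
    calc ∑ n ∈ range (G + 1), (1 - lam) * p n ≤ ∑ n ∈ range (G + 1), p n * g n := by
          refine sum_le_sum fun n hn => ?_
          rw [mul_comm]
          exact mul_le_mul_of_nonneg_left (hgl n (Nat.lt_succ_iff.mp (mem_range.mp hn))) (hp n)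
      _ ≤ ∑' n, p n * g n := hsg.sum_le_tsum _ fun n _ => mul_nonneg (hp n) (hg0 n)
  · have hs' : Summable fun k => p (k + (G + 1)) * (((k + (G + 1) : ℕ) : ℝ)) :=
      (summable_nat_add_iff (G + 1)).mpr hs
    calc ((G : ℝ) + 1) * ∑' k, p (k + (G + 1)) = ∑' k, p (k + (G + 1)) * ((G : ℝ) + 1) := by
          rw [tsum_mul_right, mul_comm]
      _ ≤ ∑' k, p (k + (G + 1)) * (((k + (G + 1) : ℕ) : ℝ)) := by
          refine Summable.tsum_le_tsum (fun k => ?_)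
            (((summable_nat_add_iff (G + 1)).mpr hsum.summable).mul_right _) hs'
          refine mul_le_mul_of_nonneg_left ?_ (hp _)
          have hk0 : (0 : ℝ) ≤ k := Nat.cast_nonneg k
          push_cast; linarith
      _ ≤ ∑' n, p n * (n : ℝ) := by
          rw [← hs.sum_add_tsum_nat_add (G + 1)]
          have : 0 ≤ ∑ n ∈ range (G + 1), p n * (n : ℝ) := sum_nonneg fun n _ => by
            have := hp n; positivity
          linarith

/-- **COUNT FAMILIES: THE VARIANCE FORMULA** (registered helper `countFamily_var_eq` of the line
`susceptibility-variance-continuity`). For a nonnegative weight `p` on `ℕ` with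
`(n+1) p(n+1) = ν g(n) p(n)`, `g ≤ 1`, `ν > 0`:
`Σ p(n) n² - (Σ p(n) n)² = ν² (Σ p(n) g(n) g(n+1) - (Σ p(n) g(n))²) + ν Σ p(n) g(n)`
(all series converge absolutely by Poisson domination). [folklore] -/
theorem countFamily_var_eq :
    ∀ (p g : ℕ → ℝ) (ν : ℝ), (∀ n, 0 ≤ p n) → (∀ n, p (n + 1) * ((n : ℝ) + 1) = ν * g n * p n) →
      (∀ n, g n ≤ 1) → 0 < ν →
      ∑' n, p n * (n : ℝ) ^ 2 - (∑' n, p n * (n : ℝ)) ^ 2 =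
        ν ^ 2 * (∑' n, p n * (g n * g (n + 1)) - (∑' n, p n * g n) ^ 2) + ν * ∑' n, p n * g n :=
  fun _ _ _ hp hrat hg1 hν => var_eq hp hrat hg1 hν

end

end Summit.AtomisticToContinuum.HydrodynamicLimit.Theorems.LightConeInLawSVC.CountLCLT
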